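import Summits.NavierStokesRegularity.NavierStokesRegularity.Theorems.TypeIQuarterGateScarEnvelopeTypeISatelliteTowerRootRateDefs
import Summits.NavierStokesRegularity.NavierStokesRegularity.Theorems.TypeIQuarterGateScarEnvelopeTypeISatelliteTowerGallerySeqCompact
import Summits.NavierStokesRegularity.NavierStokesRegularity.Theorems.TypeIQuarterGateScarEnvelopeTypeISatelliteTowerClosure
import Summits.NavierStokesRegularity.NavierStokesRegularity.Theorems.TypeIQuarterGateScarEnvelopeTypeISatelliteTowerEnvelopeStability
import Summits.NavierStokesRegularity.NavierStokesRegularity.Theorems.TypeIQuarterGateScarEnvelopeTypeISatelliteTowerHullCells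
import Literature.Analysis.FluidPDE.ScalingRecurrentSlabField
import Summits.NavierStokesRegularity.NavierStokesRegularity.Theorems.ClockStretchingLawSteadySliceLiouvilleAnalytic
import Summits.NavierStokesRegularity.NavierStokesRegularity.Theorems.OddMorawetzMorawetzKillsTypeISelfSimilarRigidity
import Summits.NavierStokesRegularity.NavierStokesRegularity.Theorems.ScenarioCensusFixedAxis
import Literature.Analysis.FluidPDE.BarkerPrange2020VorticityAlignmentTypeIHolds
import Literature.Analysis.FluidPDE.TypeIAncientMildRescale
import HarnessLib

/-!
# Satellite tower for crux `ScarEnvelopeTypeI` (stmt-NavierStokesRegularity-23843) — ROUND-46 Part E, E1–E9: WHERE NS ENTERS — UNIQUE CONTINUATION MAKES WINDOW RETURNS GLOBAL (identity theorem for the Type-I ancient mild class; exact window / a.e. / one-slice returns are exact past-DSS; momentary local self-similarity kills; Z14 at ε = 0 unconditionally)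

Module (26a) of the landing form (plate v1.1 l.131–431 = v1.0 l.114–414, byte-identical):
E1 `typeIAncientMild_analyticOnNhd_uncurry` (joint real-analyticity, BY NAME from `Theorems.analyticOnNhd_uncurry_of_oseenMild`; same statement as the tree's
`openSetLiouville_analyticOnNhd_uncurry` — kept verbatim, the gate did not dedup it); E2 ★★ `eq_past_of_eqOn_open` / E2′ `eq_past_of_ae_eq_on` (IDENTITY THEOREM
for the class); E3 ★★ `pastDss_of_eqOn_open` / E3′ `pastDss_of_ae_eq_on` / E3″ `pastDss_of_eqOn_slice` (an EXACT return of the scaling orbit on a window /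
a.e. on a window / on an open piece of ONE slice is exact past-DSS); E4 `pastDss_mul` / `pastDss_pow` / ★ `pastDss_all_of_interval` (with the tree's
`pastDss_inv`); E5 `oseenDuhamel_congr_of_Ioo` / `isTypeIAncientMild_pastCut` / `isSelfSimilar_pastCut`; E6 ★★ `eq_zero_of_pastDss_all` /
`eq_zero_of_pastDss_interval` / `eq_zero_of_locallySelfSimilar` (+ `_slice`) (MOMENTARY LOCAL SELF-SIMILARITY KILLS, Tsai via the tree's
`stub_selfSimilarRigidity`); E7 ★★ `regPt_zero_of_eq_zero_past`, `RootObj.not_locallySelfSimilar` (+ `_slice`); E8 ★ `ABTower.exists_pastDss_of_exactReturn`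
(ROUND-45's Z14 AT ε = 0, UNCONDITIONAL: no recurrence, no isolation); E9 `eq_past_rescale_of_ae_eq_on` (isolation is a one-window property).

PROVENANCE: declaration texts VERBATIM from the HOME artefact of the instrument seat nsreg-p3 g29 (cell `pub/ns-regularity-ideate`):
`round-46/partE46.lean` v1.1 (sha16 `acc8c98b977afd9e`; v1.0 9d6dadbf46a44df3 superseded; ONE section `UniqueContinuation` written against the TREE over the landed
census modules `…SatelliteTowerRootRateDefs/…GallerySeqCompact/…Closure/…EnvelopeStability/…HullCells`; memo `round-46/ROUND-46.md` v1.1 d8300660cdb27bc5),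
scored PASS TEXT+LEAN ★★ by referee ref3 g28 (`SCORE-p3-ROUND-46-0828.md` a46a6fe11ecb425f, 22:11:20Z); the author cannot write under `Theorems/`
(`perm.theorems-prover-only`); landed by the prover ns-es-p1 g6 as landing hand of record (director-ns DIRECTOR-NS #237 (3)) following the landing form
ROUND-46.md v1.1 §7 (26a–c) and ref3 F2 («(26b) = E13 only»), split into ≤ 400-line modules, the artefact's `#guard_msgs … #print axioms` certificates not landed.  `--supports stmt-NavierStokesRegularity-23843 --as helper`.

PROVENANCE OF THE INPUTS (ref3 R45-F3): everything here is unconditional ONLY because these Literature-lineage landings are tree theorems (used BY NAME,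
not re-derived): Lemarié-Rieusset 2016 Thm 9.12 local space–time analyticity `lemarieRieusset2016_local_analyticity_holds` (through
`Theorems.analyticOnNhd_uncurry_of_oseenMild`, `IsTypeIAncientMild.analyticOnNhd_slice_univ`); KNSS 2009 §4 bounded Oseen-mild uniqueness
`oseenMild_bounded_unique` (through `Theorems.ScenarioCensus.FixedAxis.eq_slice_of_eq_slice`); Tsai 1998 Thm 1 (`IsLerayProfile.exists_eq_const_of_bounded`) +
Fabes–Jones–Rivière (`classical_of_smooth_isMildNSSolutionOn_holds`) through `Theorems.stub_selfSimilarRigidity`; KNSS scaling covariance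
`IsTypeIAncientMild.nsRescale`; for E14/E15 the R43 CKN-compactness + persistence theorem `abTower_seqCompact`; for E15 Chae–Wolf 2017 Thm 1.3 through the
tree's `chaeWolf_threshold_le_pastDss_factor` (ROUND-44 Z7).

IN-TREE PRIOR ART (memo v1.1 §0′ ERRATUM, disclosed): the ε = 0 content of E4/E6/E7/E10–E12 and the compactness MECHANISM of E14–E16 already exist for the A–B class in routes RecurrentProfiles/SqueezeCycle (`stub_rlNearIdentityDSS`, H4 `stub_prScalingStabilizer` = ROUND-44 Z3 `pastDss_factors`, `stub_gkWindowIncrementRemoval` + `gk_orbitNeverRests`, `smallHullRemoval`, …); the round's own content is the IDENTITY-THEOREM LOCALISATION (arbitrarily small windows / an open piece of one slice) and the STABLE fixed-scale form E16.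

HONEST FRAMING: RIGIDITY AT ε = 0 / qualitative ε-rigidity INSTRUMENT theorems about HYPOTHETICAL Type-I zoom limits (Albritton–Barker objects of the
census of crux `TypeIQuarterGate.ScarEnvelopeTypeI`, item 23843; classes possibly empty).  Movement 0 on anything open: item 23843, route TypeIQuarterGate,
crux 1589 `RecurrentLiouville`, (ρ)/(θ′)/(υ) of ROUND-45, the DSS cells (τ), (κ) at coarse ratio, N0 and Navier–Stokes regularity are all OPEN — NS
regularity is NOT proved here.  No decl of this round is an edge or a proof-of-item (plate audit: orphan 39 / closes 0); η in E14/E15 is INEFFECTIVE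
(compactness + contradiction).  Nearest print (memo §6): Masuda 1967 / LR2016 Thm 9.12 (E2), Chae 2007 Cor 1.3 / Thm 1.5 (E6/E7), Chae 2015 Thm 1.2 and
Chae–Wolf 2017 Thms 1.3/1.5 (E14/E15) — KNOWN mechanisms, disclosed; the content is the junction with the 23843 census.
-/

noncomputable section

-- the summit-side namespace repeats a component by design (single-conjunct summit, D-0017)
set_option linter.dupNamespace false

open MeasureTheory Set Metric Filter Topology Function
open scoped ENNReal NNReal
open Literature.Analysis.FluidPDE

namespace Summit.NavierStokesRegularity.NavierStokesRegularity.Cruxes.ScarEnvelopeTypeI.ZoomDictionary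

section UniqueContinuation

variable {U W : ℝ → (EuclideanSpace ℝ (Fin 3)) → (EuclideanSpace ℝ (Fin 3))}
  {P : ℝ → (EuclideanSpace ℝ (Fin 3)) → ℝ}
  {H : ℝ → (EuclideanSpace ℝ (Fin 3)) → (EuclideanSpace ℝ (Fin 3)) →L[ℝ] (EuclideanSpace ℝ (Fin 3))}
  {M M' : ℝ}

/-! ### E1. Joint analyticity (by name) -/

/-- **E1.** Members of the Type-I ancient mild class are jointly real-analytic on the open slab `(−∞,0) × ℝ³`
(Lemarié-Rieusset 2016 Thm 9.12; tree `Theorems.analyticOnNhd_uncurry_of_oseenMild`, fed with the class API). -/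
theorem typeIAncientMild_analyticOnNhd_uncurry (hU : IsTypeIAncientMild M U) :
    AnalyticOnNhd ℝ (uncurry U) (Iio (0 : ℝ) ×ˢ (univ : Set (EuclideanSpace ℝ (Fin 3)))) :=
  Summit.NavierStokesRegularity.NavierStokesRegularity.Theorems.analyticOnNhd_uncurry_of_oseenMild
    hU.contDiffOn (fun _ _ hst ht x => hU.mild_eq_heatExtension hst ht x) hU.hasTypeITimeDecay

/-! ### E2. The identity theorem for the class -/

/-- ★★ **E2. IDENTITY THEOREM FOR THE CLASS.**  Two Type-I ancient mild fields (any constants) which agree on a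
nonempty open subset of the open slab agree at every point of the open past: the slab is preconnected and both
fields are jointly real-analytic there (E1). -/
theorem eq_past_of_eqOn_open (hU : IsTypeIAncientMild M U) (hW : IsTypeIAncientMild M' W)
    {O : Set (ℝ × (EuclideanSpace ℝ (Fin 3)))} (hO : IsOpen O) (hne : O.Nonempty)
    (hOs : O ⊆ Iio (0 : ℝ) ×ˢ (univ : Set (EuclideanSpace ℝ (Fin 3))))
    (h : EqOn (uncurry U) (uncurry W) O) : ∀ t < 0, ∀ x, U t x = W t x := by
  obtain ⟨z₀, hz₀⟩ := hne
  have hpre : IsPreconnected (Iio (0 : ℝ) ×ˢ (univ : Set (EuclideanSpace ℝ (Fin 3)))) :=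
    isPreconnected_Iio.prod isPreconnected_univ
  have hfg : uncurry U =ᶠ[𝓝 z₀] uncurry W := Filter.eventuallyEq_of_mem (hO.mem_nhds hz₀) h
  intro t ht x
  exact (typeIAncientMild_analyticOnNhd_uncurry hU).eqOn_of_preconnected_of_eventuallyEq
    (typeIAncientMild_analyticOnNhd_uncurry hW) hpre (hOs hz₀) hfg (mk_mem_prod ht (mem_univ x))

/-- ★★ **E2′. Identity theorem, a.e. form.**  Two Type-I ancient mild fields agreeing ALMOST EVERYWHERE on a set
`K` whose interior meets the open slab agree at every point of the open past (continuity on the open part, then E2). -/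
theorem eq_past_of_ae_eq_on (hU : IsTypeIAncientMild M U) (hW : IsTypeIAncientMild M' W)
    {K : Set (ℝ × (EuclideanSpace ℝ (Fin 3)))}
    (hK : (interior K ∩ Iio (0 : ℝ) ×ˢ (univ : Set (EuclideanSpace ℝ (Fin 3)))).Nonempty)
    (h : ∀ᵐ z ∂(volume.restrict K), U z.1 z.2 = W z.1 z.2) : ∀ t < 0, ∀ x, U t x = W t x := by
  set O : Set (ℝ × (EuclideanSpace ℝ (Fin 3))) :=
    interior K ∩ Iio (0 : ℝ) ×ˢ (univ : Set (EuclideanSpace ℝ (Fin 3))) with hOdef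
  have hO : IsOpen O := isOpen_interior.inter (isOpen_Iio.prod isOpen_univ)
  have hOs : O ⊆ Iio (0 : ℝ) ×ˢ (univ : Set (EuclideanSpace ℝ (Fin 3))) := inter_subset_right
  have hOK : O ⊆ K := inter_subset_left.trans interior_subset
  have hae : uncurry U =ᵐ[volume.restrict O] uncurry W :=
    ae_restrict_of_ae_restrict_of_subset hOK (h.mono fun z hz => hz)
  have hcU : ContinuousOn (uncurry U) O := hU.continuousOn_uncurry.mono hOs
  have hcW : ContinuousOn (uncurry W) O := hW.continuousOn_uncurry.mono hOs
  exact eq_past_of_eqOn_open hU hW hO hK hOs (Measure.eqOn_open_of_ae_eq hae hO hcU hcW)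

/-! ### E3. Exact returns of the scaling orbit on a window are exact past-DSS -/

/-- ★★ **E3. AN EXACT RETURN ON A WINDOW IS AN EXACT RETURN ON THE PAST.**  If the rescaling `U_c = c U(c²t, cx)`
(`c > 0`) of a Type-I ancient mild field agrees with `U` on a nonempty open space–time window inside the slab, then
`U` is exactly past-DSS with factor `c`.  (The rescaling is in the class with the same constant — KNSS scaling
covariance `IsTypeIAncientMild.nsRescale` — and E2 applies.)  This is the `ε = 0` instance of the orbit-isolation
input of ROUND-45 Z14, now for ANY window and unconditionally. -/
theorem pastDss_of_eqOn_open (hU : IsTypeIAncientMild M U) {c : ℝ} (hc : 0 < c)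
    {O : Set (ℝ × (EuclideanSpace ℝ (Fin 3)))} (hO : IsOpen O) (hne : O.Nonempty)
    (hOs : O ⊆ Iio (0 : ℝ) ×ˢ (univ : Set (EuclideanSpace ℝ (Fin 3))))
    (h : EqOn (uncurry (nsRescale c U)) (uncurry U) O) : ∀ t < 0, ∀ x, nsRescale c U t x = U t x :=
  eq_past_of_eqOn_open (hU.nsRescale hc) hU hO hne hOs h

/-- ★★ **E3′. a.e. form** (the measure-theoretic currency of Z14): `U_c = U` a.e. on a set `K` whose interior meets
the slab ⇒ exact past-DSS with factor `c`. -/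
theorem pastDss_of_ae_eq_on (hU : IsTypeIAncientMild M U) {c : ℝ} (hc : 0 < c)
    {K : Set (ℝ × (EuclideanSpace ℝ (Fin 3)))}
    (hK : (interior K ∩ Iio (0 : ℝ) ×ˢ (univ : Set (EuclideanSpace ℝ (Fin 3)))).Nonempty)
    (h : ∀ᵐ z ∂(volume.restrict K), nsRescale c U z.1 z.2 = U z.1 z.2) :
    ∀ t < 0, ∀ x, nsRescale c U t x = U t x :=
  eq_past_of_ae_eq_on (hU.nsRescale hc) hU hK h

/-- ★★ **E3″. ONE-SLICE form — unique continuation in space + forward uniqueness + identity theorem back in time.**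
If `U_c(t₀, ·) = U(t₀, ·)` on a nonempty OPEN SUBSET of ONE slice `t₀ < 0` (anywhere in `ℝ³`), then `U` is exactly
past-DSS with factor `c`: slice analyticity (`IsTypeIAncientMild.analyticOnNhd_slice_univ`, LR 2016 Thm 9.12)
spreads the equality over the slice, bounded Oseen-mild uniqueness (`FixedAxis.eq_slice_of_eq_slice`, KNSS 2009 §4)
pushes it to `(t₀, 0) × ℝ³`, and E3 pulls it back to the whole past. -/
theorem pastDss_of_eqOn_slice (hU : IsTypeIAncientMild M U) {c : ℝ} (hc : 0 < c) {t₀ : ℝ} (ht₀ : t₀ < 0)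
    {S : Set (EuclideanSpace ℝ (Fin 3))} (hS : IsOpen S) (hSne : S.Nonempty)
    (h : EqOn (nsRescale c U t₀) (U t₀) S) : ∀ t < 0, ∀ x, nsRescale c U t x = U t x := by
  have hV : IsTypeIAncientMild M (nsRescale c U) := hU.nsRescale hc
  -- (i) unique continuation in space on the slice
  have hslice : nsRescale c U t₀ = U t₀ := by
    obtain ⟨x₀, hx₀⟩ := hSne
    have h1 := (hV.analyticOnNhd_slice_univ ht₀).eqOn_of_preconnected_of_eventuallyEq
      (hU.analyticOnNhd_slice_univ ht₀) isPreconnected_univ (mem_univ x₀)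
      (Filter.eventuallyEq_of_mem (hS.mem_nhds hx₀) h)
    exact funext fun x => h1 (mem_univ x)
  -- (ii) forward uniqueness of bounded Oseen-mild solutions on `(t₀, 0)`
  have hfwd : ∀ t, t₀ < t → t < 0 → nsRescale c U t = U t := fun t h1 h2 =>
    Summit.NavierStokesRegularity.NavierStokesRegularity.Theorems.ScenarioCensus.FixedAxis.eq_slice_of_eq_slice
      hV hU hslice h1 h2
  -- (iii) identity theorem in space–time from the open set `(t₀, 0) × ℝ³`
  refine pastDss_of_eqOn_open hU hc (isOpen_Ioo.prod isOpen_univ)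
    ⟨((t₀ / 2 : ℝ), (0 : EuclideanSpace ℝ (Fin 3))),
      mk_mem_prod (show t₀ / 2 ∈ Ioo t₀ 0 from ⟨by linarith, by linarith⟩) (mem_univ _)⟩
    (prod_mono Ioo_subset_Iio_self le_rfl) ?_
  rintro ⟨t, x⟩ hz
  obtain ⟨ht, -⟩ := mem_prod.1 hz
  show nsRescale c U t x = U t x
  rw [hfwd t ht.1 ht.2]

/-! ### E4. The exact past factors form a group; an interval of factors generates `(0, ∞)` -/

/-- **E4a.** Exact past factors multiply. -/
theorem pastDss_mul {c d : ℝ} (hd : 0 < d)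
    (hc' : ∀ t < 0, ∀ x, nsRescale c U t x = U t x) (hd' : ∀ t < 0, ∀ x, nsRescale d U t x = U t x) :
    ∀ t < 0, ∀ x, nsRescale (c * d) U t x = U t x := by
  intro t ht x
  have hdt : d ^ 2 * t < 0 := mul_neg_of_pos_of_neg (pow_pos hd 2) ht
  have h1 := hd' t ht x
  rw [nsRescale_apply] at h1
  rw [nsRescale_mul, nsRescale_apply, hc' _ hdt (d • x)]
  exact h1

-- **E4b.** Exact past factors invert: `pastDss_inv` is the tree's (`…SatelliteTowerDssNecklace`, R44).

/-- **E4c.** Exact past factors have all their powers as factors. -/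
theorem pastDss_pow {c : ℝ} (hc : 0 < c) (h : ∀ t < 0, ∀ x, nsRescale c U t x = U t x) :
    ∀ n : ℕ, ∀ t < 0, ∀ x, nsRescale (c ^ n) U t x = U t x
  | 0 => by
      intro t ht x
      rw [pow_zero, nsRescale_one]
  | n + 1 => by
      rw [pow_succ]
      exact pastDss_mul hc (pastDss_pow hc h n) h

/-- ★ **E4. AN INTERVAL OF EXACT FACTORS GENERATES EVERY FACTOR.**  If every `c ∈ (a, 1]` (`0 < a < 1`) is an exact
past factor of `U`, then EVERY `c > 0` is: the multiplicative group generated by `(a, 1]` is `(0, ∞)`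
(`c = (c^{1/n})^n` with `c^{1/n} ∈ (a, 1]` for `c ≤ 1`, inverses for `c > 1`). -/
theorem pastDss_all_of_interval {a : ℝ} (ha1 : a < 1)
    (h : ∀ c ∈ Ioc a 1, ∀ t < 0, ∀ x, nsRescale c U t x = U t x) :
    ∀ c : ℝ, 0 < c → ∀ t < 0, ∀ x, nsRescale c U t x = U t x := by
  -- first every `c ∈ (0, 1]`
  have hle : ∀ c : ℝ, 0 < c → c ≤ 1 → ∀ t < 0, ∀ x, nsRescale c U t x = U t x := by
    intro c hc hc1
    obtain ⟨n, hn⟩ := exists_pow_lt_of_lt_one hc ha1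
    have hn0 : n ≠ 0 := by
      rintro rfl
      rw [pow_zero] at hn
      linarith
    have hr0 : 0 < c ^ ((n : ℝ)⁻¹) := Real.rpow_pos_of_pos hc _
    have hrn : (c ^ ((n : ℝ)⁻¹)) ^ n = c := Real.rpow_inv_natCast_pow hc.le hn0
    have hr1 : c ^ ((n : ℝ)⁻¹) ≤ 1 := Real.rpow_le_one hc.le hc1 (by positivity)
    have har : a < c ^ ((n : ℝ)⁻¹) := by
      by_contra hra
      push Not at hra
      have h2 : c ≤ a ^ n := by
        calc c = (c ^ ((n : ℝ)⁻¹)) ^ n := hrn.symm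
          _ ≤ a ^ n := pow_le_pow_left₀ hr0.le hra n
      linarith
    have key := pastDss_pow hr0 (h _ ⟨har, hr1⟩) n
    rw [hrn] at key
    exact key
  intro c hc
  rcases le_or_gt c 1 with hc1 | hc1
  · exact hle c hc hc1
  · have key := pastDss_inv (inv_pos.2 hc) (hle c⁻¹ (inv_pos.2 hc) (inv_le_one_of_one_le₀ hc1.le))
    simpa only [inv_inv] using key

/-! ### E5. The past cut-off stays in the class -/

/-- The Oseen–Duhamel term only sees the fields at times in `(s, t)`. -/
theorem oseenDuhamel_congr_of_Ioo {ν s t : ℝ} {u u' : ℝ → (EuclideanSpace ℝ (Fin 3)) → (EuclideanSpace ℝ (Fin 3))}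
    (h : ∀ τ ∈ Ioo s t, u τ = u' τ) (x : EuclideanSpace ℝ (Fin 3)) :
    oseenDuhamel ν s u u t x = oseenDuhamel ν s u' u' t x := by
  rw [oseenDuhamel_apply, oseenDuhamel_apply]
  refine setIntegral_congr_fun measurableSet_Ioo fun τ hτ => ?_
  simp only [h τ hτ]

/-- **E5a.** The `t ≥ 0` cut-off of a Type-I ancient mild field is a Type-I ancient mild field with the same
constant (the class only looks at `t < 0`; the Duhamel term only at times in `(s, t)`). -/
theorem isTypeIAncientMild_pastCut (hU : IsTypeIAncientMild M U) :
    IsTypeIAncientMild M (fun t x => if t < 0 then U t x else 0) := by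
  have hs : ∀ t : ℝ, t < 0 →
      (fun x : EuclideanSpace ℝ (Fin 3) => if t < 0 then U t x else 0) = U t :=
    fun t ht => funext fun x => if_pos ht
  refine ⟨?_, fun t ht => ?_, fun s t hst ht x => ?_, fun t ht x => ?_⟩
  · refine hU.contDiffOn.congr fun p hp => ?_
    have hp1 : p.1 < 0 := (mem_prod.1 hp).1
    simp only [uncurry, if_pos hp1]
  · show VectorCalculus.IsDivFree (fun x => if t < 0 then U t x else 0)
    rw [hs t ht]
    exact hU.isDivFree ht
  · have hs0 : s < 0 := hst.trans ht
    show (if t < 0 then U t x else 0) =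
      heatFlow (fun x => if s < 0 then U s x else 0) (t - s) x -
        oseenDuhamel 1 s (fun t x => if t < 0 then U t x else 0) (fun t x => if t < 0 then U t x else 0) t x
    rw [if_pos ht, hs s hs0, oseenDuhamel_congr_of_Ioo (u' := U) (fun τ hτ => hs τ (hτ.2.trans ht)) x]
    exact hU.mild_eq hst ht x
  · show ‖(if t < 0 then U t x else 0)‖ ≤ M / Real.sqrt (-t)
    rw [if_pos ht]
    exact hU.norm_le ht x

/-- **E5b.** Exact past self-similarity with every factor makes the cut-off self-similar in the Literature sense
(`IsSelfSimilar`: `nsRescale c v = v` for all `c > 0`, all times). -/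
theorem isSelfSimilar_pastCut (h : ∀ c : ℝ, 0 < c → ∀ t < 0, ∀ x, nsRescale c U t x = U t x) :
    IsSelfSimilar (fun t x => if t < 0 then U t x else 0) := by
  intro c hc
  funext t x
  rw [nsRescale_apply]
  by_cases ht : t < 0
  · have key := h c hc t ht x
    rw [nsRescale_apply] at key
    have ht' : c ^ 2 * t < 0 := mul_neg_of_pos_of_neg (by positivity) ht
    simp only [if_pos ht, if_pos ht', key]
  · have ht' : ¬ c ^ 2 * t < 0 := not_lt.2 (mul_nonneg (sq_nonneg c) (not_lt.1 ht))
    simp only [if_neg ht, if_neg ht', smul_zero]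

/-! ### E6. Momentary local self-similarity kills -/

/-- ★★ **E6a.** A Type-I ancient mild field which is exactly past-DSS with EVERY factor `c > 0` vanishes
identically on the open past: the cut-off is a self-similar member of the class (E5), and self-similar members
vanish (`Theorems.stub_selfSimilarRigidity`: Leray's profile equation on one slice + Tsai 1998 Thm 1 at `q = ∞`
+ the Oseen gauge).  (Chae 2007 Thm 1.5's conclusion «a self-similar scaling limit vanishes», for the class.) -/
theorem eq_zero_of_pastDss_all (hU : IsTypeIAncientMild M U)
    (hall : ∀ c : ℝ, 0 < c → ∀ t < 0, ∀ x, nsRescale c U t x = U t x) : ∀ t < 0, ∀ x, U t x = 0 := by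
  have hcut := isTypeIAncientMild_pastCut hU
  have hss := isSelfSimilar_pastCut hall
  intro t ht x
  have h1 := Summit.NavierStokesRegularity.NavierStokesRegularity.Theorems.stub_selfSimilarRigidity M _ hcut hss t ht x
  simpa only [if_pos ht] using h1

/-- ★★ **E6a′.** … with every factor in an interval `(a, 1)` (`0 < a < 1`): E4 makes every `c > 0` a factor. -/
theorem eq_zero_of_pastDss_interval (hU : IsTypeIAncientMild M U) {a : ℝ} (ha0 : 0 < a) (ha1 : a < 1)
    (h : ∀ c ∈ Ioo a 1, ∀ t < 0, ∀ x, nsRescale c U t x = U t x) : ∀ t < 0, ∀ x, U t x = 0 := by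
  have hint : ∀ c ∈ Ioc a 1, ∀ t < 0, ∀ x, nsRescale c U t x = U t x := by
    intro c hc
    rcases hc.2.lt_or_eq with hc1 | rfl
    · exact h c ⟨hc.1, hc1⟩
    · intro t _ x
      rw [nsRescale_one]
  have _ := ha0
  exact eq_zero_of_pastDss_all hU (pastDss_all_of_interval ha1 hint)

/-- ★★ **E6. MOMENTARY LOCAL SELF-SIMILARITY KILLS.**  If the rescalings `U_c`, `c ∈ (a, 1)` (`0 < a < 1`), of a
Type-I ancient mild field all agree with `U` on ONE nonempty open space–time window inside the slab — i.e. the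
similarity profile `V(y, s) = √(−t) U(t, √(−t) y)` is STATIONARY on a window, for a window of similarity times —
then `U ≡ 0` on the open past.  The window may sit anywhere (it need not see the root or the final time). -/
theorem eq_zero_of_locallySelfSimilar (hU : IsTypeIAncientMild M U) {a : ℝ} (ha0 : 0 < a) (ha1 : a < 1)
    {O : Set (ℝ × (EuclideanSpace ℝ (Fin 3)))} (hO : IsOpen O) (hne : O.Nonempty)
    (hOs : O ⊆ Iio (0 : ℝ) ×ˢ (univ : Set (EuclideanSpace ℝ (Fin 3))))
    (h : ∀ c ∈ Ioo a 1, EqOn (uncurry (nsRescale c U)) (uncurry U) O) : ∀ t < 0, ∀ x, U t x = 0 :=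
  eq_zero_of_pastDss_interval hU ha0 ha1 fun c hc =>
    pastDss_of_eqOn_open hU (ha0.trans hc.1) hO hne hOs (h c hc)

/-- ★★ **E6′. One-slice form.**  If `U_c(t₀, ·) = U(t₀, ·)` on a nonempty open `S ⊆ ℝ³` for every `c ∈ (a, 1)`
at ONE time `t₀ < 0`, then `U ≡ 0` on the open past. -/
theorem eq_zero_of_locallySelfSimilar_slice (hU : IsTypeIAncientMild M U) {a : ℝ} (ha0 : 0 < a) (ha1 : a < 1)
    {t₀ : ℝ} (ht₀ : t₀ < 0) {S : Set (EuclideanSpace ℝ (Fin 3))} (hS : IsOpen S) (hSne : S.Nonempty)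
    (h : ∀ c ∈ Ioo a 1, EqOn (nsRescale c U t₀) (U t₀) S) : ∀ t < 0, ∀ x, U t x = 0 :=
  eq_zero_of_pastDss_interval hU ha0 ha1 fun c hc =>
    pastDss_of_eqOn_slice hU (ha0.trans hc.1) ht₀ hS hSne (h c hc)

/-! ### E7. Census reading: no rooted A–B object is momentarily locally self-similar -/

/-- A field vanishing on the open past is regular at the root. -/
theorem regPt_zero_of_eq_zero_past (h : ∀ t < 0, ∀ x, U t x = 0) : RegPt U 0 := by
  refine ⟨1, one_pos, 0, (ae_restrict_iff' (isOpen_parabolicCylinder _ _).measurableSet).2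
    (ae_of_all _ fun z hz => ?_)⟩
  rw [mem_parabolicCylinder] at hz
  have hz1 : z.1 < 0 := by simpa using hz.1.2
  simp [h z.1 hz1 z.2]

/-- ★★ **E7. NO ROOTED A–B OBJECT IS MOMENTARILY LOCALLY SELF-SIMILAR** — anywhere in the slab, for any interval of
scales: by E6 it would vanish on the open past, hence be regular at the root. -/
theorem RootObj.not_locallySelfSimilar {n : TNode} (hn : RootObj M n) {a : ℝ} (ha0 : 0 < a) (ha1 : a < 1)
    {O : Set (ℝ × (EuclideanSpace ℝ (Fin 3)))} (hO : IsOpen O) (hne : O.Nonempty)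
    (hOs : O ⊆ Iio (0 : ℝ) ×ˢ (univ : Set (EuclideanSpace ℝ (Fin 3)))) :
    ¬ ∀ c ∈ Ioo a 1, EqOn (uncurry (nsRescale c n.U)) (uncurry n.U) O := fun h =>
  hn.2 (regPt_zero_of_eq_zero_past (eq_zero_of_locallySelfSimilar hn.1.1 ha0 ha1 hO hne hOs h))

/-- ★★ **E7′. One-slice form**: no rooted A–B object has `U_c(t₀,·) = U(t₀,·)` on an open ball for all `c ∈ (a,1)`. -/
theorem RootObj.not_locallySelfSimilar_slice {n : TNode} (hn : RootObj M n) {a : ℝ} (ha0 : 0 < a) (ha1 : a < 1)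
    {t₀ : ℝ} (ht₀ : t₀ < 0) {S : Set (EuclideanSpace ℝ (Fin 3))} (hS : IsOpen S) (hSne : S.Nonempty) :
    ¬ ∀ c ∈ Ioo a 1, EqOn (nsRescale c n.U t₀) (n.U t₀) S := fun h =>
  hn.2 (regPt_zero_of_eq_zero_past (eq_zero_of_locallySelfSimilar_slice hn.1.1 ha0 ha1 ht₀ hS hSne h))

/-! ### E8. Z14 at ε = 0, unconditionally -/

/-- ★ **E8. Z14 AT ε = 0.**  An A–B object whose scaling orbit RETURNS EXACTLY on a window — `U_{e^σ} = U` a.e. on a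
set `K` whose interior meets the slab, `σ ≠ 0` — is exactly past-DSS with a factor `> 1` (E3′, and E4b if `σ < 0`).
In ROUND-45 Z14 the same conclusion needed recurrence AND the isolation hypothesis (hiso) for ε-returns; at ε = 0
neither is needed and the window is arbitrary. -/
theorem ABTower.exists_pastDss_of_exactReturn (hT : ABTower M U P H) {σ : ℝ} (hσ : σ ≠ 0)
    {K : Set (ℝ × (EuclideanSpace ℝ (Fin 3)))}
    (hK : (interior K ∩ Iio (0 : ℝ) ×ˢ (univ : Set (EuclideanSpace ℝ (Fin 3)))).Nonempty)
    (h : ∀ᵐ z ∂(volume.restrict K), nsRescale (Real.exp σ) U z.1 z.2 = U z.1 z.2) :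
    ∃ μ : ℝ, 1 < μ ∧ ∀ t < 0, ∀ x, nsRescale μ U t x = U t x := by
  have hp := pastDss_of_ae_eq_on hT.1 (Real.exp_pos σ) hK h
  rcases hσ.lt_or_gt with hneg | hpos
  · refine ⟨(Real.exp σ)⁻¹, ?_, pastDss_inv (Real.exp_pos σ) hp⟩
    rw [← Real.exp_neg]
    exact Real.one_lt_exp_iff.2 (by linarith)
  · exact ⟨Real.exp σ, Real.one_lt_exp_iff.2 hpos, hp⟩

/-! ### E9. Isolation is a one-window property -/

/-- **E9.** For a Type-I ancient mild field and two factors `c, c' > 0`: `U_c = U_{c'}` a.e. ON A WINDOW `K`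
(interior meeting the slab) already gives `U_c = U_{c'}` at EVERY point of the open past — the conclusion of Z14's
isolation hypothesis (hiso) is a one-window statement. -/
theorem eq_past_rescale_of_ae_eq_on (hU : IsTypeIAncientMild M U) {c c' : ℝ} (hc : 0 < c) (hc' : 0 < c')
    {K : Set (ℝ × (EuclideanSpace ℝ (Fin 3)))}
    (hK : (interior K ∩ Iio (0 : ℝ) ×ˢ (univ : Set (EuclideanSpace ℝ (Fin 3)))).Nonempty)
    (h : ∀ᵐ z ∂(volume.restrict K), nsRescale c U z.1 z.2 = nsRescale c' U z.1 z.2) :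
    ∀ t < 0, ∀ x, nsRescale c U t x = nsRescale c' U t x :=
  eq_past_of_ae_eq_on (hU.nsRescale hc) (hU.nsRescale hc') hK h

end UniqueContinuation

end Summit.NavierStokesRegularity.NavierStokesRegularity.Cruxes.ScarEnvelopeTypeI.ZoomDictionary

end
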